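import Summits.CriticalPhenomena.PercolationContinuityZ3.Theorems.Transplant.SkelFrmBChoiceCreepY3
import Summits.CriticalPhenomena.PercolationContinuityZ3.Theorems.Transplant.SkelFrmBChoiceHabYCoreW
import HarnessLib

/-!
# N2 (frames-only node `SamePDropOfSkeletonFrm₁`, OPEN) — (ζ″) under (R-44)/(R-45): THE V HABITAT ROW FOR THE y′-CORRIDOR, core and box form —
# every region box of the (C) y′-schedule reads, in fine-0, BELOW THE TIGHT AFFINE FORWARD ROOM `hF 1 = cRvY3 + 54·s₀ + 2` (`NegB.hFR`, SkelFrmBChoiceRoomV):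
# **`habY_box_V : rdHi₀ lo hi ≤ cRvY3 + 54·s₀ + 1`** for any box in the shape the three phase boxes share (p5-g16's `kgCorrSchedY_region_run_box /
# _park₁_box / _park₂_box_step`), from the pure-integer `habY_gap_core` + `habY_reading_core` (SkelFrmBChoiceHabYCoreW); the phase instances and `hPRY_V` are the sibling file
# SkelFrmBChoiceRegionsYV.  This is the row hp-8 g42's `PCells2V.mem_habΩV_of_footprint (h4 : σ·(ψ g ⊥ − cenS⊥) ≤ hF − 1)` consumes on the (C)
# side at y′-steps (σ = 1, ⊥ = axis 0), i.e. LOCATED-3's run-phase reach certified against the affine room `c 1 + 54·s₀ + 2` (G = 106 at `BSlot.small3`; the TIGHT certified reach with the parking set's symmetric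
# growth — p5-g16 14:07:23Z —; a signed-growth parking set would save ≈ 4·s₀) with the creep's OWN `v`-dependence kept

* **`habY_box_V`** (at the tuple: any `lo hi` with `hi 0 ≤ κ·v_L − v_L + X0 + j·(R′0 + |v_L|)`,
  `κ·sL − Y0 + j·(sL − R′0) ≤ lo 1 ≤ hi 1 ≤ κ·(sL + 2) + Y1`, `0 ≤ κ ≤ N + 1`, `0 ≤ j ≤ 41`, `X0 ≤ 100·n_L + (N+1)R′0 + 200R′0`, `0 ≤ Y0`,
  `U·Y0 ≤ 24·Δ`, `0 ≤ Y1`, `U·Y1 ≤ 25·Δ`); `m2_mul_dec2_lt` (generic: `m₂·dec₂ < T − (P+ρ−1)`).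
NON-VACUITY: value rows at the closed tuple (`EqNumL`, the two box-slot floors, `5 ≤ Kq`).
builds on p205010 (kernel theorem, internal audit signed; external expert review pending) — nothing in this file uses p205010; NOTHING is claimed about the
open node `SamePDropOfSkeletonFrm₁`.
Lane `prim-bschramm`, seat `prim-bschramm-stmt` (gen 21); helper file (`--supports stmt-CriticalPhenomena-4575 --as helper`).
[cite: KozmaNitzan2024, §4 Lemma 11 (p. 22), Lemma 12 (pp. 23–25)] [cite: MartineauTassion2017, §4.3 Lemma 4.2]
-/

open scoped Classical

noncomputable section

namespace Summit.CriticalPhenomena.PercolationContinuityZ3.Theorems.Transplant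

namespace PlanarSkeletonFrm

namespace NegB

open Literature.Probability.Percolation Literature.Probability.LatticeModels SimpleGraph
open Literature.Probability.Percolation.KozmaNitzan.Cells (oth)
open SkelConc (Consts)
open Skelφ (shearUnit kgSL kgSLY kgM₁Y kgM₂Y kgE₁Y kgXY kgCtr2Y kgHw2Y kgA₁Yp kgT₁Y kgTY kgDec₁Y kgDec₂Y dS rdLo rdHi KGYRows)
open TwoAxis.Para (modulus)
open Neg

/-! ## §2 At the tuple of record -/

section CreepY

variable (κ : Consts) {V : Type} [DecidableEq V] [Countable V] {G : SimpleGraph V} [G.LocallyFinite] (Φ : PlanarSkeletonFrm G) (t : V) (p : unitInterval)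
  (D : Skelφ.StepI.DataNS V) (g f mk : ℕ)

/- The tuple's atoms as hygiene-free local notations (they expand syntactically at each use; importers see the expanded terms). -/
set_option hygiene false in local notation "NYᵣ" => kgNYv0 κ Φ t p D g f mk (qxYQ4 κ Φ t p D g f) (WxYQ4 κ Φ t p D g f)
set_option hygiene false in local notation "qYᵣ" => kgqY κ Φ t p D g f (qxYQ4 κ Φ t p D g f)
set_option hygiene false in local notation "WYᵣ" => kgWY κ Φ t p D g f (WxYQ4 κ Φ t p D g f)
set_option hygiene false in local notation "Rᵣ" => kgR κ Φ t p D mk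
set_option hygiene false in local notation "nᵣ" => nL κ Φ t p D g f
set_option hygiene false in local notation "ℓᵣ" => ℓL κ Φ t p D g f
set_option hygiene false in local notation "hᵣ" => hL κ Φ t p D g f
set_option hygiene false in local notation "vᵣ" => vL κ Φ t p D g f
set_option hygiene false in local notation "Uᵣ" => shearUnit (nL κ Φ t p D g f) (hL κ Φ t p D g f)
set_option hygiene false in local notation "Δᵣ" => modulus (nL κ Φ t p D g f) (hL κ Φ t p D g f) (vL κ Φ t p D g f) (vβL κ Φ t p D g f)
set_option hygiene false in local notation "sLᵣ" => kgSL (nL κ Φ t p D g f) (ℓL κ Φ t p D g f) (hL κ Φ t p D g f)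
set_option hygiene false in local notation "s0ᵣ" => (((fcellsA κ Φ t p D g f).s 0 : ℕ) : ℤ)
set_option hygiene false in local notation "r0ᵣ" => (((fcellsA κ Φ t p D g f).r 0 : ℕ) : ℤ)
set_option hygiene false in local notation "Kᵣ" => ((Neg.K κ : ℕ) : ℤ)
set_option hygiene false in local notation "LOᵣ" => rdLo (Aof κ) (nL κ Φ t p D g f) (hL κ Φ t p D g f) (vL κ Φ t p D g f) (vβL κ Φ t p D g f) (prFA κ Φ t p D g f).c₀ (prFA κ Φ t p D g f).c₁ (prFA κ Φ t p D g f).D (arrLoY3 κ Φ t p D g f mk) (arrHiY3 κ Φ t p D g f mk) 0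
set_option hygiene false in local notation "HIᵣ" => rdHi (Aof κ) (nL κ Φ t p D g f) (hL κ Φ t p D g f) (vL κ Φ t p D g f) (vβL κ Φ t p D g f) (prFA κ Φ t p D g f).c₀ (prFA κ Φ t p D g f).c₁ (prFA κ Φ t p D g f).D (arrLoY3 κ Φ t p D g f mk) (arrHiY3 κ Φ t p D g f mk) 0
set_option hygiene false in local notation "s1ᵣ" => (((fcellsA κ Φ t p D g f).s 1 : ℕ) : ℤ)
set_option hygiene false in local notation "r1ᵣ" => (((fcellsA κ Φ t p D g f).r 1 : ℕ) : ℤ)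
set_option hygiene false in local notation "LO1ᵣ" => rdLo (Aof κ) (nL κ Φ t p D g f) (hL κ Φ t p D g f) (vL κ Φ t p D g f) (vβL κ Φ t p D g f) (prFA κ Φ t p D g f).c₀ (prFA κ Φ t p D g f).c₁ (prFA κ Φ t p D g f).D (arrLoY3 κ Φ t p D g f mk) (arrHiY3 κ Φ t p D g f mk) 1
set_option hygiene false in local notation "HI1ᵣ" => rdHi (Aof κ) (nL κ Φ t p D g f) (hL κ Φ t p D g f) (vL κ Φ t p D g f) (vβL κ Φ t p D g f) (prFA κ Φ t p D g f).c₀ (prFA κ Φ t p D g f).c₁ (prFA κ Φ t p D g f).D (arrLoY3 κ Φ t p D g f mk) (arrHiY3 κ Φ t p D g f mk) 1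

/-- **THE V HABITAT ROW, BOX FORM**: any box `[lo, hi]` in the common shape of the three phase boxes reads `rdHi₀ ≤ cRvY3 + 54·s₀ + 1`. [this work] -/
theorem habY_box_V (hKq : 5 ≤ Neg.Kq κ) (hN : EqNumL κ Φ t p D g f) (hg : gFloorKG κ Φ t p D mk ≤ g) (hg2 : 40 * Neg.K κ * KS0.R'0 κ Φ t p D mk ≤ g)
    (lo hi : Site 2) {kk j X0 Y0 Y1 : ℤ} (hκ0 : 0 ≤ kk) (hκ : kk ≤ ((NYᵣ : ℕ) : ℤ) + 1) (hj0 : 0 ≤ j) (hj : j ≤ 41)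
    (hhiB : hi 0 ≤ kk * vᵣ - vᵣ + X0 + j * (((Rᵣ : ℕ) : ℤ) + |vᵣ|)) (hloB1 : kk * sLᵣ - Y0 + j * (sLᵣ - ((Rᵣ : ℕ) : ℤ)) ≤ lo 1)
    (hhiB1 : hi 1 ≤ kk * (sLᵣ + 2) + Y1) (hlh : lo 1 ≤ hi 1)
    (hX0 : X0 ≤ 100 * ((nᵣ : ℕ) : ℤ) + (((NYᵣ : ℕ) : ℤ) + 1) * ((Rᵣ : ℕ) : ℤ) + 200 * ((Rᵣ : ℕ) : ℤ)) (hY00 : 0 ≤ Y0) (hY0 : ((Uᵣ : ℕ) : ℤ) * Y0 ≤ 24 * Δᵣ)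
    (hY10 : 0 ≤ Y1) (hY1 : ((Uᵣ : ℕ) : ℤ) * Y1 ≤ 25 * Δᵣ) :
    rdHi (Aof κ) (nL κ Φ t p D g f) (hL κ Φ t p D g f) (vL κ Φ t p D g f) (vβL κ Φ t p D g f) (prFA κ Φ t p D g f).c₀ (prFA κ Φ t p D g f).c₁
          (prFA κ Φ t p D g f).D lo hi 0 ≤ ((cRvY3 κ Φ t p D g f mk : ℕ) : ℤ) + 54 * s0ᵣ + 1 := by
  -- the tuple's facts
  obtain ⟨hsc0, -, hn1, hA0, hDp, hm, -, -, hkq, -⟩ := hsc_Q κ Φ t p D g f hN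
  obtain ⟨hnR', hs40, hbig, hR1, -, -⟩ := valsQ_floor κ Φ t p D g f mk hN hg hg2
  have hUs := UsL_le_modulus κ Φ t p D g f hN
  have hNle : ((NYᵣ : ℕ) : ℤ) ≤ 21 * Kᵣ + 2 := by exact_mod_cast kgNYv0_le κ Φ t p D g f mk (qxYQ4 κ Φ t p D g f) (WxYQ4 κ Φ t p D g f) hN hg
  have H := kgYRows0_of κ Φ t p D g f mk (qxYQ4 κ Φ t p D g f) (WxYQ4 κ Φ t p D g f) hN hg
  obtain ⟨-, hE2, hE3⟩ := H.kgE₁Y_spec NYᵣ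
  have hv := hN.v_le
  have hd1eq := (dec₁Y_eq_Q κ Φ t p D g f mk).1
  obtain ⟨ha1lo, ha1hi⟩ := a1Y_bounds_3 κ Φ t p D g f mk hKq hN hg hg2 NYᵣ hNle
  obtain ⟨ha2lo, ha2hi⟩ := a2Y_le_3 κ Φ t p D g f mk hKq hN hg hg2 NYᵣ hNle
  obtain ⟨hXY0, hXYle⟩ := XY_le_3 κ Φ t p D g f mk hKq hN hg hg2 NYᵣ hNle
  have hCeq := kgCtr2Y_eq_zero H NYᵣ
  have hHeq := kgHw2Y_eq_zero nᵣ ℓᵣ hᵣ vᵣ Rᵣ qYᵣ WYᵣ NYᵣ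
  have hP0 := kgSL_le_natDiv κ Φ t p D g f hN
  have hP1 := Skelφ.natDiv_le_kgSLY hn1 ℓᵣ hᵣ
  have hP0nat : ((nᵣ * ℓᵣ / Uᵣ : ℕ) : ℤ) = ((nᵣ : ℕ) : ℤ) * ℓᵣ / (Uᵣ : ℕ) := by push_cast; rfl
  rw [hP0nat] at hP0 hP1
  rw [kgSLY_eq_kgSL] at hP1
  have h80 : 80 ≤ Neg.K κ := by have := Neg.K_eq κ; omega
  have hK80 : (80 : ℤ) ≤ Kᵣ := by exact_mod_cast h80
  have hRR : ((KS0.R'0 κ Φ t p D mk : ℕ) : ℤ) = ((Rᵣ : ℕ) : ℤ) := rfl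
  rw [hRR] at hnR' hR1 hs40
  have hR0 : (0 : ℤ) ≤ ((Rᵣ : ℕ) : ℤ) := by linarith
  have hn0 : (0 : ℤ) < ((nᵣ : ℕ) : ℤ) := by exact_mod_cast hn1
  have hn1z : (1 : ℤ) ≤ ((nᵣ : ℕ) : ℤ) := by exact_mod_cast hn1
  have hA1 : 1 ≤ Aof κ := by linarith
  have hs0one : (1 : ℤ) ≤ s0ᵣ := by exact_mod_cast (fcellsA κ Φ t p D g f).hs 0
  have hs0p : (0 : ℤ) < s0ᵣ := by linarith
  -- `Δ ≤ nℓ ≤ U·sL + 2U − 2`, `n ≤ U`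
  have hmod := (Skelφ.NegPrm.modulus_vβOf hn1 hᵣ ℓᵣ vᵣ).2
  have hvβ : vβL κ Φ t p D g f = Skelφ.NegPrm.vβOf nᵣ hᵣ ℓᵣ vᵣ := rfl
  rw [← hvβ] at hmod
  have hU : (0 : ℤ) < (Uᵣ : ℕ) := Skelφ.shearUnit_pos hn1 _
  have hUn : ((nᵣ : ℕ) : ℤ) ≤ (Uᵣ : ℕ) := by rw [shearUnit_cast]; linarith [abs_nonneg hᵣ]
  have hΔU : Δᵣ ≤ ((Uᵣ : ℕ) : ℤ) * sLᵣ + 2 * ((Uᵣ : ℕ) : ℤ) := by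
    have hfl := Int.lt_mul_ediv_self_add (x := ((nᵣ : ℕ) : ℤ) * ℓᵣ - (Uᵣ : ℕ) + 1) hU
    unfold Skelφ.kgSL; linarith
  -- `c₀′·A·Δ = s₀·D`
  have hr0 : r0ᵣ = 40 * ((Neg.Kq κ : ℕ) : ℤ) * s0ᵣ := by
    rw [PCells2.r_eq, show ((fcellsA κ Φ t p D g f).K : ℤ) = Neg.K κ by exact_mod_cast (fcellsA_K κ Φ t p D g f).1,
      show Kᵣ = 40 * ((Neg.Kq κ : ℕ) : ℤ) by exact_mod_cast Neg.K_eq κ]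
  have e0 : (prFA κ Φ t p D g f).c₀ * Aof κ * Δᵣ = s0ᵣ * (prFA κ Φ t p D g f).D := by
    rw [hr0] at hsc0
    have h' : (40 * ((Neg.Kq κ : ℕ) : ℤ)) * ((prFA κ Φ t p D g f).c₀ * Aof κ * Δᵣ) = (40 * ((Neg.Kq κ : ℕ) : ℤ)) * (s0ᵣ * (prFA κ Φ t p D g f).D) := by
      linear_combination hsc0
    have h40 : (40 * ((Neg.Kq κ : ℕ) : ℤ)) ≠ 0 := by positivity
    exact mul_left_cancel₀ h40 h'
  -- the box rows and the `/2` facts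
  obtain ⟨elo0, ehi0, elo1, ehi1⟩ := arrY3_apply κ Φ t p D g f mk
  have hbox : kgCtr2Y nᵣ vᵣ Rᵣ 0 WYᵣ NYᵣ - kgHw2Y nᵣ ℓᵣ hᵣ vᵣ Rᵣ 0 qYᵣ WYᵣ NYᵣ ≤ 2 * arrLoY3 κ Φ t p D g f mk 0 ∧ 2 * arrLoY3 κ Φ t p D g f mk 0 ≤ kgCtr2Y nᵣ vᵣ Rᵣ 0 WYᵣ NYᵣ - kgHw2Y nᵣ ℓᵣ hᵣ vᵣ Rᵣ 0 qYᵣ WYᵣ NYᵣ + 1 ∧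
      2 * arrHiY3 κ Φ t p D g f mk 0 ≤ kgCtr2Y nᵣ vᵣ Rᵣ 0 WYᵣ NYᵣ + kgHw2Y nᵣ ℓᵣ hᵣ vᵣ Rᵣ 0 qYᵣ WYᵣ NYᵣ ∧ kgCtr2Y nᵣ vᵣ Rᵣ 0 WYᵣ NYᵣ + kgHw2Y nᵣ ℓᵣ hᵣ vᵣ Rᵣ 0 qYᵣ WYᵣ NYᵣ - 1 ≤ 2 * arrHiY3 κ Φ t p D g f mk 0 := by
    rw [elo0, ehi0]; omega
  have hlo1 : arrLoY3 κ Φ t p D g f mk 1 = (((NYᵣ : ℕ) : ℤ) + 1) * sLᵣ + kgXY nᵣ ℓᵣ hᵣ vᵣ Rᵣ 0 qYᵣ WYᵣ NYᵣ - ((nᵣ : ℕ) : ℤ) * ℓᵣ / (Uᵣ : ℕ) := by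
    rw [elo1, kgSLY_eq_kgSL]; push_cast; ring
  have hT2 : vᵣ * (((Uᵣ : ℕ) : ℤ) * arrHiY3 κ Φ t p D g f mk 1 + ((Uᵣ : ℕ) : ℤ) - 1) = vᵣ * (((Uᵣ : ℕ) : ℤ) * arrLoY3 κ Φ t p D g f mk 1) + vᵣ * (((Uᵣ : ℕ) : ℤ) * (((nᵣ : ℕ) : ℤ) * ℓᵣ / (Uᵣ : ℕ)) + ((Uᵣ : ℕ) : ℤ) - 1) := by
    rw [ehi1, elo1]; push_cast; ring
  -- `XY ≥ 17·sL`, `lo₀ + hi₀ = Ctr2Y`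
  have hXY17 : 20 * sLᵣ ≤ kgXY nᵣ ℓᵣ hᵣ vᵣ Rᵣ 0 qYᵣ WYᵣ NYᵣ := by
    have hq := kgqY_qxYQ4 κ Φ t p D g f hN
    rw [hP0nat] at hq
    have hd0 : (0 : ℤ) ≤ ((dS nᵣ ℓᵣ hᵣ : ℕ) : ℤ) := Nat.cast_nonneg _
    have hm10 : (0 : ℤ) ≤ ((kgM₁Y nᵣ vᵣ Rᵣ 0 WYᵣ NYᵣ : ℕ) : ℤ) := Nat.cast_nonneg _
    have hm20 : (0 : ℤ) ≤ ((kgM₂Y nᵣ ℓᵣ hᵣ vᵣ Rᵣ 0 qYᵣ WYᵣ NYᵣ : ℕ) : ℤ) := Nat.cast_nonneg _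
    have hN0' : (0 : ℤ) ≤ ((NYᵣ : ℕ) : ℤ) := Nat.cast_nonneg _
    have p1 : (0 : ℤ) ≤ (((NYᵣ : ℕ) : ℤ) + 1) * ((Rᵣ : ℕ) : ℤ) := mul_nonneg (by linarith) hR0
    have p2 : (0 : ℤ) ≤ (((NYᵣ : ℕ) : ℤ) + 1) * ((dS nᵣ ℓᵣ hᵣ : ℕ) : ℤ) := mul_nonneg (by linarith) hd0
    have p3 : (0 : ℤ) ≤ (((kgM₁Y nᵣ vᵣ Rᵣ 0 WYᵣ NYᵣ : ℕ) : ℤ) + 1) * (((Rᵣ : ℕ) : ℤ) + ((0 : ℕ) : ℤ)) := mul_nonneg (by linarith) (by push_cast; linarith)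
    have p4 : (0 : ℤ) ≤ (((kgM₂Y nᵣ ℓᵣ hᵣ vᵣ Rᵣ 0 qYᵣ WYᵣ NYᵣ : ℕ) : ℤ) + 1) * (((Rᵣ : ℕ) : ℤ) + ((0 : ℕ) : ℤ)) := mul_nonneg (by linarith) (by push_cast; linarith)
    unfold Skelφ.kgXY
    linarith
  -- `XY` in `U`-units: `50·U·XY ≤ 1081·Δ + 2700·U`
  have hXYs : 50 * (((Uᵣ : ℕ) : ℤ) * kgXY nᵣ ℓᵣ hᵣ vᵣ Rᵣ 0 qYᵣ WYᵣ NYᵣ) ≤ 1081 * Δᵣ + 2700 * ((Uᵣ : ℕ) : ℤ) := by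
    have hq := kgqY_qxYQ4 κ Φ t p D g f hN
    rw [hP0nat] at hq
    have hd2 : ((dS nᵣ ℓᵣ hᵣ : ℕ) : ℤ) ≤ 2 := by exact_mod_cast Skelφ.dS_le_two _ _ _
    have hN1 : ((NYᵣ : ℕ) : ℤ) + 1 ≤ 21 * Kᵣ + 3 := by linarith
    have hN0' : (0 : ℤ) ≤ ((NYᵣ : ℕ) : ℤ) + 1 := by positivity
    have hK200 : (200 : ℤ) ≤ Kᵣ := by
      have h5 : (5 : ℤ) ≤ ((Neg.Kq κ : ℕ) : ℤ) := by exact_mod_cast hKq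
      have e : Kᵣ = 40 * ((Neg.Kq κ : ℕ) : ℤ) := by exact_mod_cast Neg.K_eq κ
      linarith
    have p1 : (((NYᵣ : ℕ) : ℤ) + 1) * ((Rᵣ : ℕ) : ℤ) ≤ (21 * Kᵣ + 3) * ((Rᵣ : ℕ) : ℤ) := mul_le_mul_of_nonneg_right hN1 hR0
    have p2 : (((NYᵣ : ℕ) : ℤ) + 1) * ((dS nᵣ ℓᵣ hᵣ : ℕ) : ℤ) ≤ (((NYᵣ : ℕ) : ℤ) + 1) * 2 := mul_le_mul_of_nonneg_left hd2 hN0'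
    have p3 : (((kgM₁Y nᵣ vᵣ Rᵣ 0 WYᵣ NYᵣ : ℕ) : ℤ) + 1) * (((Rᵣ : ℕ) : ℤ) + ((0 : ℕ) : ℤ)) ≤ 198 * ((Rᵣ : ℕ) : ℤ) := by
      push_cast; simp only [add_zero]; exact mul_le_mul_of_nonneg_right ha1hi hR0
    have p4 : (((kgM₂Y nᵣ ℓᵣ hᵣ vᵣ Rᵣ 0 qYᵣ WYᵣ NYᵣ : ℕ) : ℤ) + 1) * (((Rᵣ : ℕ) : ℤ) + ((0 : ℕ) : ℤ)) ≤ 42 * ((Rᵣ : ℕ) : ℤ) := by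
      push_cast; simp only [add_zero]; exact mul_le_mul_of_nonneg_right ha2hi hR0
    have hKR : 200 * ((Rᵣ : ℕ) : ℤ) ≤ Kᵣ * ((Rᵣ : ℕ) : ℤ) := mul_le_mul_of_nonneg_right hK200 hR0
    have e1 : (21 * Kᵣ + 3) * ((Rᵣ : ℕ) : ℤ) = 21 * (Kᵣ * ((Rᵣ : ℕ) : ℤ)) + 3 * ((Rᵣ : ℕ) : ℤ) := by ring
    have e2 : (40 : ℤ) * Kᵣ * ((Rᵣ : ℕ) : ℤ) = 40 * (Kᵣ * ((Rᵣ : ℕ) : ℤ)) := by ring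
    have h40K : 40 * Kᵣ ≤ sLᵣ + 1 := by
      have := le_mul_of_one_le_right (show (0 : ℤ) ≤ 40 * Kᵣ by linarith) hR1; linarith
    rw [e2] at hs40
    have hXYle' : 40 * kgXY nᵣ ℓᵣ hᵣ vᵣ Rᵣ 0 qYᵣ WYᵣ NYᵣ ≤ 863 * sLᵣ + 2063 + 9720 * ((Rᵣ : ℕ) : ℤ) := by
      unfold Skelφ.kgXY; linarith
    have hR8000 : 8000 * ((Rᵣ : ℕ) : ℤ) ≤ sLᵣ + 1 := by linarith
    have h1 := mul_le_mul_of_nonneg_left hXYle' hU.le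
    have h2 := mul_le_mul_of_nonneg_left hR8000 hU.le
    have h3 := mul_le_mul_of_nonneg_left hbig hU.le
    have e3 : ((Uᵣ : ℕ) : ℤ) * (863 * sLᵣ + 2063 + 9720 * ((Rᵣ : ℕ) : ℤ)) = 863 * (((Uᵣ : ℕ) : ℤ) * sLᵣ) + 2063 * ((Uᵣ : ℕ) : ℤ) + 9720 * (((Uᵣ : ℕ) : ℤ) * ((Rᵣ : ℕ) : ℤ)) := by ring
    have e4 : ((Uᵣ : ℕ) : ℤ) * (8000 * ((Rᵣ : ℕ) : ℤ)) = 8000 * (((Uᵣ : ℕ) : ℤ) * ((Rᵣ : ℕ) : ℤ)) := by ring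
    have e5 : ((Uᵣ : ℕ) : ℤ) * (sLᵣ + 1) = ((Uᵣ : ℕ) : ℤ) * sLᵣ + ((Uᵣ : ℕ) : ℤ) := by ring
    have e6 : ((Uᵣ : ℕ) : ℤ) * (40 * kgXY nᵣ ℓᵣ hᵣ vᵣ Rᵣ 0 qYᵣ WYᵣ NYᵣ) = 40 * (((Uᵣ : ℕ) : ℤ) * kgXY nᵣ ℓᵣ hᵣ vᵣ Rᵣ 0 qYᵣ WYᵣ NYᵣ) := by ring
    rw [e3, e6] at h1; rw [e4, e5] at h2
    linarith
  have hsum0 : arrLoY3 κ Φ t p D g f mk 0 + arrHiY3 κ Φ t p D g f mk 0 = kgCtr2Y nᵣ vᵣ Rᵣ 0 WYᵣ NYᵣ := by omega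
  -- the creep as the midpoint, the readings as nested floors
  obtain ⟨hc, -⟩ := cRvY3_eq κ Φ t p D g f mk hKq hN hg hg2
  rw [hc]
  unfold cmidY3
  simp only [Skelφ.rdLo_zero, Skelφ.rdHi_zero]
  set Zm := (Δᵣ * arrLoY3 κ Φ t p D g f mk 0 - max (vᵣ * (((Uᵣ : ℕ) : ℤ) * arrLoY3 κ Φ t p D g f mk 1)) (vᵣ * (((Uᵣ : ℕ) : ℤ) * arrHiY3 κ Φ t p D g f mk 1 + ((Uᵣ : ℕ) : ℤ) - 1))) with hZm
  set Zp := (Δᵣ * arrHiY3 κ Φ t p D g f mk 0 - min (vᵣ * (((Uᵣ : ℕ) : ℤ) * arrLoY3 κ Φ t p D g f mk 1)) (vᵣ * (((Uᵣ : ℕ) : ℤ) * arrHiY3 κ Φ t p D g f mk 1 + ((Uᵣ : ℕ) : ℤ) - 1))) with hZp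
  set ZB := (Δᵣ * hi 0 - min (vᵣ * (((Uᵣ : ℕ) : ℤ) * lo 1)) (vᵣ * (((Uᵣ : ℕ) : ℤ) * hi 1 + ((Uᵣ : ℕ) : ℤ) - 1))) with hZB
  have hqm := Int.mul_ediv_self_le (x := Aof κ * Zm) (ne_of_gt hn0)
  have hqm' := Int.lt_mul_ediv_self_add (x := Aof κ * Zm) hn0
  have hqp := Int.mul_ediv_self_le (x := Aof κ * Zp) (ne_of_gt hn0)
  have hqp' := Int.lt_mul_ediv_self_add (x := Aof κ * Zp) hn0
  have hFm := Int.mul_ediv_self_le (x := (prFA κ Φ t p D g f).c₀ * (Aof κ * Zm / ((nᵣ : ℕ) : ℤ))) (ne_of_gt hDp)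
  have hFm' := Int.lt_mul_ediv_self_add (x := (prFA κ Φ t p D g f).c₀ * (Aof κ * Zm / ((nᵣ : ℕ) : ℤ))) hDp
  have hFp := Int.mul_ediv_self_le (x := (prFA κ Φ t p D g f).c₀ * (Aof κ * Zp / ((nᵣ : ℕ) : ℤ))) (ne_of_gt hDp)
  have hFp' := Int.lt_mul_ediv_self_add (x := (prFA κ Φ t p D g f).c₀ * (Aof κ * Zp / ((nᵣ : ℕ) : ℤ))) hDp
  have hqB := Int.mul_ediv_self_le (x := Aof κ * ZB) (ne_of_gt hn0)
  have hqB' := Int.lt_mul_ediv_self_add (x := Aof κ * ZB) hn0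
  have hFB := Int.mul_ediv_self_le (x := (prFA κ Φ t p D g f).c₀ * (Aof κ * ZB / ((nᵣ : ℕ) : ℤ))) (ne_of_gt hDp)
  have hFB' := Int.lt_mul_ediv_self_add (x := (prFA κ Φ t p D g f).c₀ * (Aof κ * ZB / ((nᵣ : ℕ) : ℤ))) hDp
  obtain ⟨-, hF2⟩ := floorA_bounds hA1 hn0 hm hs0p hDp e0 hqm hqm' hFm hFm'
  obtain ⟨-, hF4⟩ := floorA_bounds hA1 hn0 hm hs0p hDp e0 hqp hqp' hFp hFp'
  obtain ⟨hF3B, -⟩ := floorA_bounds hA1 hn0 hm hs0p hDp e0 hqB hqB' hFB hFB'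
  have hgap := habY_gap_core (hn := hn1z) (hUn := hUn) (hUs := hUs) (hΔU := hΔU) (hs := hbig) (hK := hK80) (hR := hR1) (hKR := hs40) (hnR := hnR')
    (hv := hv) (hN0 := Nat.cast_nonneg _) (hN := hNle) (ha1 := ha1lo) (hXY0 := hXY17) (hXY := hXYs) (hP0 := hP0) (hP1 := hP1)
    (hC := hCeq) (hsum0 := hsum0) (hlo1 := hlo1) (hG := rfl) (hT₁ := rfl) (hT₂ := hT2) (hAm := hZm) (hAp := hZp)
    (hκ0 := hκ0) (hκ := hκ) (hj0 := hj0) (hj := hj) (hhiB := hhiB) (hloB1 := hloB1) (hhiB1 := hhiB1) (hlh := hlh)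
    (hX0 := hX0) (hY00 := hY00) (hY0 := hY0) (hY10 := hY10) (hY1 := hY1) (hZB := hZB)
  exact habY_reading_core (hn := hn1z) (hΔ := by linarith) (hs0 := hs0one) hgap hF2 hF4 hF3B

end CreepY

end NegB

end PlanarSkeletonFrm

end Summit.CriticalPhenomena.PercolationContinuityZ3.Theorems.Transplant

end
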